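import Summits.ResolutionOfSingularities.ResolutionOfSingularities.Theorems.HilbertSamuelEliminationSigmaMaxModificationsCorridor3NearStep
import Summits.ResolutionOfSingularities.ResolutionOfSingularities.Theorems.HilbertSamuelEliminationSigmaMaxModificationsCorridor3WLadderMovingTwo
import HarnessLib

/-!
# [OURS · L1 W4.2] GRADE ZERO of the row `stub_Wlow3M_two` — for ALL primes and ALL maximal origins, modulo the
# (F1♯)-form `Theorem314_geomDir` of CJS Thm. 3.14 (crux chain w42, line `w_ladder` v5b; `--supports stmt-…-19249`, helper)

Stub worker res-L1-w42-stub-3 (gen 3). Stub-2's `…Corridor3WLadderGradeZero` (p501168) proves grade `0` of the (F1)-regime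
row `Wlow3CharM p` modulo the print-faithful numerical Thm 3.14 (`Theorem314_dim_lt_dirDim`), using the regime `QCharRegime p`
ONLY to produce `CharHypothesis` at the blown-up marked point. Outside the regime (p = 2, dim X = 3) `CharHypothesis` fails, but
its (F1♯) replacement `GeomDirHypothesis` («`char κ = 0 ∨ ē + 2 ≤ 2·char`») is AUTOMATIC at every marked point with `ē ≤ 2`
(`geomDirHypothesis_of_geomDirDim_le_two`, p502286) — and a W-low chain has `ē ≤ 2` throughout. Hence, modulo the OURS binder
`Theorem314_geomDir` (`…MovingTwoDefs`, the numerical shadow of the directrix theorem 2.14♯), stub-2's argument runs for EVERY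
prime and EVERY maximal origin, with the grade bound in place of the regime:

* `false_of_isBlownUp_of_stateGood_geomDir` — stub-2's CORE with `CharHypothesis` ↦ `GeomDirHypothesis`;
* `false_of_isBlownUp_of_dirDim_eq_zero_geomDir` — from a maximal origin (any prime, any regime), a marked point with `e = 0`
  and `ē ≤ 2` is never blown up with a point above it (case `ν = Φ` fact-free via stub-2's `false_of_isBlownUp_of_isRegular`;
  case `ν ≠ Φ` via s42's good states + the binder);
* a WAITING step changes neither `e` (stub-2's `dirDim_eq_of_step_of_not_isBlownUp`) nor `ē` (lead-1's
  `CanonicalNearStep.geomDirDim_eq_of_not_isBlownUp`, module `…Corridor3NearStep`);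
* `noMovingNearChainFrom_of_dirDim_eq_zero_geomDir` — **from a stage with `e = 0` and `ē ≤ 2` reached from ANY maximal origin
  there is NO MOVING chain (any grade `G`)** = the `e = 0` half of the restricted third door of `wlowUnitsM_of_extraction_free`,
  for all origins, WITHOUT isolation;
* `maxOriginNoMovingNearChainAt_grade0_of_theorem314_geomDir (hF) (p) : MaxOriginNoMovingNearChainAt p 3 (ē = 0)` — grade 0
  of the ALL-ORIGIN row `WlowM p`; restricted to the two regimes: `wlow3TwoM_grade0_of_theorem314_geomDir` (input of the
  char-2 row) and `wlow3CharM_grade0_of_theorem314_geomDir` (re-derives stub-2's grade 0, the binder being stronger).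
* `theorem314_dim_lt_dirDim_of_geomDir : Theorem314_geomDir → Theorem314_dim_lt_dirDim` (the OURS binder is STRONGER than print).

OURS (cell res-hironaka, slot W4.2); NOT statements of the manuscript [Hironaka2017] nor of [CossartJannsenSaito2020];
AI-drafted, weaker than expert review. References: CJS LNM 2270 Lemma 2.31, Def. 3.1, Thm. 3.3, Thm. 3.14, Lemma 3.15 (proof),
Rem. 6.29 (1) [CossartJannsenSaito2020]; H. Mizutani, Nagoya Math. J. 52 (1973) Thm. 2.8 [Mizutani1973HironakaGroupSchemes];
CHAIN w42 v3.8-D; stub-2's p501168.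
-/

noncomputable section

-- namespace `…Corridor3.Moving` re-enters `…Corridor3` (module convention of the Moving files)
set_option linter.dupNamespace false

open CategoryTheory AlgebraicGeometry TopologicalSpace IsLocalRing
open Literature.AlgebraicGeometry.Resolution Literature.RingTheory.HilbertSamuel

universe u

open Summit.ResolutionOfSingularities.ResolutionOfSingularities.Theorems.CampaignW42
open Literature.AlgebraicGeometry.CossartJannsenSaito2020
open Summit.ResolutionOfSingularities.ResolutionOfSingularities.Theorems.SigmaMaxModificationsCorridor3

namespace Summit.ResolutionOfSingularities.ResolutionOfSingularities.Theorems.SigmaMaxModificationsCorridor3.Moving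

variable {R : ∀ S : Scheme.{u}, CentreSeq S → Prop} {N : ℕ} {ν : ℕ → ℕ}

/-! ## The binder is stronger than the print-faithful fact -/

/-- `Theorem314_geomDir` (the (F1♯)-form) implies the typed print-faithful `Theorem314_dim_lt_dirDim` ((F1) ⇒ (F1♯)).
[folklore] -/
theorem theorem314_dim_lt_dirDim_of_geomDir (hF : Theorem314_geomDir.{u}) : Theorem314_dim_lt_dirDim.{u} :=
  fun X X' _ _ π D N x' x hX hD hπ hN hx hxD hchar hnear =>
    hF X X' π D N x' x hX hD hπ hN hx hxD (geomDirHypothesis_of_charHypothesis hchar) hnear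

/-! ## Core, modulo the binder: a good stage, `e = 0`, (F1♯) — never blown up with a point above it -/

/-- **CORE (modulo `Theorem314_geomDir`)** — stub-2's `false_of_isBlownUp_of_stateGood` with (F1) replaced by (F1♯): at a GOOD
stage whose marked point lies in the `ν`-stratum, satisfies `GeomDirHypothesis` and has `e = 0`, the marked point is not blown up
with a near point above it. [cite: CossartJannsenSaito2020, Thm. 3.14, Lemma 3.15 (proof)] -/
theorem false_of_isBlownUp_of_stateGood_geomDir (hF : Theorem314_geomDir.{u}) (hRf : OracleFunctional R)
    {k : Type u} [Field k] {s s' : MarkedStage.{u}} (hg : StateGood k R N ν s.W s.L s.P)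
    (hpt : s.pt ∈ Scheme.hsStratum s.W N ν) (hb : s.IsBlownUp R N ν) (hst : CanonicalNearStep R N ν s s')
    (hgeo : @GeomDirHypothesis s.W s.ln s.pt) (he : dirDim s = 0) : False := by
  haveI : IsLocallyNoetherian s.W := s.ln
  obtain ⟨C, P', hcs, hmem⟩ := hb
  obtain ⟨C₂, P₂', hln, x', hcs₂, hπ, -, hx', -⟩ := hst
  obtain rfl : C = C₂ := IsCanonicalStep.centre_unique hRf hcs hcs₂
  haveI : IsLocallyNoetherian (blowup C) := hln
  have hnear : Scheme.hsFun (blowup C) N x' = Scheme.hsFun s.W N s.pt := by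
    rw [Scheme.mem_hsStratum_iff.mp hx', Scheme.mem_hsStratum_iff.mp hpt]
  have key := hF s.W (blowup C) (blowup.π C) C N x' s.pt hg.isExcellent (hg.isPermissible hcs₂)
    (blowup.isBlowup C) hg.dim_le hπ hmem hgeo hnear
  have h0 : Scheme.dirDim s.W s.pt = 0 := he
  rw [h0, Nat.cast_zero] at key
  have hle : stalkIdeal C s.pt ≤ maximalIdeal _ := (mem_support_iff_stalkIdeal_le C s.pt).mp hmem
  have hne : stalkIdeal C s.pt ≠ ⊤ := fun h => (maximalIdeal.isMaximal _).ne_top (top_le_iff.mp (h ▸ hle))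
  haveI : Nontrivial (s.W.presheaf.stalk s.pt ⧸ stalkIdeal C s.pt) := Ideal.Quotient.nontrivial_iff.mpr hne
  have hnn : (0 : WithBot ℕ∞) ≤ ringKrullDim (s.W.presheaf.stalk s.pt ⧸ stalkIdeal C s.pt) :=
    ringKrullDim_nonneg_of_nontrivial
  exact lt_irrefl _ (hnn.trans_lt key)

/-! ## From any maximal origin: a marked point with `e = 0`, `ē ≤ 2` is never blown up -/

/-- **From a maximal origin of ANY prime `p` (no regime), a marked point with `e = 0` and `ē ≤ 2` is never blown up with a point
above it** (modulo `Theorem314_geomDir`): case `ν = Φ^{(3)}` is stub-2's fact-free `false_of_isBlownUp_of_isRegular`; case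
`ν ≠ Φ^{(3)}` is `false_of_isBlownUp_of_stateGood_geomDir` with good states from s42's `stateGood_init_general` and (F1♯) from
`ē ≤ 2`. [cite: CossartJannsenSaito2020, Thm. 3.14, Lemma 3.15 (proof), Lemma 2.31] -/
theorem false_of_isBlownUp_of_dirDim_eq_zero_geomDir (hF : Theorem314_geomDir.{u}) (hRf : OracleFunctional R)
    (hRa : OracleAdmissible R) {p : ℕ} {X : Scheme.{u}} [IsLocallyNoetherian X] {x : X} (hX : IsMaximalOrigin p 3 ν X x)
    {s s' : MarkedStage.{u}} (hreach : Reaches R 3 ν (MarkedStage.init X x) s)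
    (hb : s.IsBlownUp R 3 ν) (hst : CanonicalNearStep R 3 ν s s') (he : dirDim s = 0) (hē : s.geomDirDim ≤ 2) : False := by
  obtain ⟨k, _, _, f, -, hft, hqc⟩ := hX.exists_structure
  have hpt : s.pt ∈ Scheme.hsStratum s.W 3 ν := pt_mem_hsStratum_of_reaches hX.mem_stratum hreach
  haveI : IsLocallyNoetherian s.W := s.ln
  by_cases hν : ν = iterPSum 3 Phi
  · obtain ⟨d, hd, hd3⟩ := exists_ringKrullDim_stalk_eq_of_topologicalKrullDim_le
      (dim_le_of_reaches hreach (d := 3) hX.dim_le) s.pt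
    have hreg : s.pt ∈ Scheme.regularLocus s.W :=
      (Scheme.mem_regularLocus_iff_hsFun_eq (N := 3) s.pt hd hd3).mpr ((Scheme.mem_hsStratum_iff.mp hpt).trans hν)
    exact false_of_isBlownUp_of_isRegular hRf ((Scheme.mem_regularLocus _).mp hreg) hb hst he
  · haveI := hft
    haveI := hqc
    haveI := hX.isReduced
    have hgood0 : StateGood k R 3 ν X (Labelling.init X) none :=
      stateGood_init_general hRa f hX.dim_le hX.maximal hν
    have hgood : StateGood k R 3 ν s.W s.L s.P := stateGood_of_reaches hgood0 hreach
    exact false_of_isBlownUp_of_stateGood_geomDir hF hRf hgood hpt hb hst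
      (@geomDirHypothesis_of_geomDirDim_le_two s.W s.ln s.pt hē) he

/-- **`e = 0` AND `ē` PROPAGATE along `Reaches`** from such a stage: every further step is a waiting step (a genuine one is
impossible), and waiting steps change neither `e` nor `ē`. [cite: CossartJannsenSaito2020, Thm. 3.14, Def. 2.26] -/
theorem dirDim_eq_zero_and_geomDirDim_eq_of_reaches_geomDir (hF : Theorem314_geomDir.{u}) (hRf : OracleFunctional R)
    (hRa : OracleAdmissible R) {p : ℕ} {X : Scheme.{u}} [IsLocallyNoetherian X] {x : X} (hX : IsMaximalOrigin p 3 ν X x)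
    {s₀ s : MarkedStage.{u}} (h₀ : Reaches R 3 ν (MarkedStage.init X x) s₀) (he : dirDim s₀ = 0) (hē : s₀.geomDirDim ≤ 2)
    (h : Reaches R 3 ν s₀ s) : dirDim s = 0 ∧ s.geomDirDim = s₀.geomDirDim := by
  induction h with
  | refl => exact ⟨he, rfl⟩
  | @tail t t' htreach hlast ih =>
    have hreach : Reaches R 3 ν (MarkedStage.init X x) t := h₀.trans htreach
    by_cases hb : t.IsBlownUp R 3 ν
    · exact (false_of_isBlownUp_of_dirDim_eq_zero_geomDir hF hRf hRa hX hreach hb hlast ih.1 (ih.2 ▸ hē)).elim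
    · exact ⟨(dirDim_eq_of_step_of_not_isBlownUp hlast hb).trans ih.1,
        (hlast.geomDirDim_eq_of_not_isBlownUp hb).trans ih.2⟩

/-- **NO MOVING CHAIN THROUGH A MARKED POINT WITH `e = 0` AND `ē ≤ 2`, FROM ANY MAXIMAL ORIGIN (modulo `Theorem314_geomDir`)**:
from every stage `s` reached from a maximal origin at level `3` (any prime, any regime, no isolation) with `e = 0` and `ē ≤ 2`
there is no chain of canonical near steps whose marked point is blown up infinitely often (indeed none is ever blown up).
This is the `e = 0` half of the restricted third door consumed by `wlowUnitsM_of_extraction_free` (p502286).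
[cite: CossartJannsenSaito2020, Thm. 3.14, Lemma 3.15 (proof)] -/
theorem noMovingNearChainFrom_of_dirDim_eq_zero_geomDir (hF : Theorem314_geomDir.{u}) (hRf : OracleFunctional R)
    (hRa : OracleAdmissible R) {p : ℕ} {X : Scheme.{u}} [IsLocallyNoetherian X] {x : X} (hX : IsMaximalOrigin p 3 ν X x)
    {s : MarkedStage.{u}} (hreach : Reaches R 3 ν (MarkedStage.init X x) s) (he : dirDim s = 0) (hē : s.geomDirDim ≤ 2)
    (G : MarkedStage.{u} → Prop) : NoMovingNearChainFrom R 3 ν s G := by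
  rintro ⟨c, h0, hstep, -, hmov⟩
  obtain ⟨m, -, hb⟩ := hmov 0
  have hcm : Reaches R 3 ν s (c m) := reaches_chain h0 hstep m
  obtain ⟨hem, hēm⟩ := dirDim_eq_zero_and_geomDirDim_eq_of_reaches_geomDir hF hRf hRa hX hreach he hē hcm
  exact false_of_isBlownUp_of_dirDim_eq_zero_geomDir hF hRf hRa hX (hreach.trans hcm) hb (hstep m) hem (hēm ▸ hē)

/-! ## Grade zero of the all-origin row, and of both registered W-low rows -/

/-- **GRADE ZERO OF THE ALL-ORIGIN MOVING W-LOW ROW, modulo `Theorem314_geomDir`**: for EVERY `p`, from every maximal origin at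
level `3` there is no infinite MOVING chain of closed near points of constant grade `ē = 0` (at the first stage `e ≤ ē = 0`).
[cite: CossartJannsenSaito2020, Thm. 3.14, Lemma 3.15 (proof), Lemma 2.31] -/
theorem maxOriginNoMovingNearChainAt_grade0_of_theorem314_geomDir (hF : Theorem314_geomDir.{u}) (p : ℕ) :
    MaxOriginNoMovingNearChainAt.{u} p 3 fun s => s.geomDirDim = 0 := by
  intro R hRf hRa ν X _ x hX
  rintro ⟨c, h0, hstep, hG, hmov⟩
  have he : dirDim (c 0) = 0 := Nat.eq_zero_of_le_zero ((dirDim_le_geomDirDim (c 0)).trans (hG 0).le)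
  exact noMovingNearChainFrom_of_dirDim_eq_zero_geomDir hF hRf hRa hX h0 he (by rw [hG 0]; exact Nat.zero_le 2)
    (fun s => s.geomDirDim = 0) ⟨c, Relation.ReflTransGen.refl, hstep, hG, hmov⟩

/-- **Grade zero of the characteristic-2 row `Wlow3TwoM p`** (any `p`; the row is about `p = 2`), modulo `Theorem314_geomDir`.
[folklore] -/
theorem wlow3TwoM_grade0_of_theorem314_geomDir (hF : Theorem314_geomDir.{u}) (p : ℕ) :
    MaxOriginNoMovingNearChainAtQ.{u} p 3 (fun N ν X x => ¬ Helpers.QCharRegime p N ν X x) fun s => s.geomDirDim = 0 :=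
  (maxOriginNoMovingNearChainAt_grade0_of_theorem314_geomDir hF p).toQ _

/-- Grade zero of the (F1)-regime row `Wlow3CharM p` re-derived from the stronger binder (stub-2's p501168 gives it from the
print-faithful fact). [folklore] -/
theorem wlow3CharM_grade0_of_theorem314_geomDir (hF : Theorem314_geomDir.{u}) (p : ℕ) :
    MaxOriginNoMovingNearChainAtQ.{u} p 3 (Helpers.QCharRegime p) fun s => s.geomDirDim = 0 :=
  (maxOriginNoMovingNearChainAt_grade0_of_theorem314_geomDir hF p).toQ _

end Summit.ResolutionOfSingularities.ResolutionOfSingularities.Theorems.SigmaMaxModificationsCorridor3.Moving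

end
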